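import Mathlib
import Summits.ResolutionOfSingularities.ResolutionOfSingularities.Theorems.SyzygyFlatteningDefs
import Literature.FieldTheory.TranscendenceDegree.CdInduction
import HarnessLib

/-!
# Syzygy-flattening tower: the base change `(k, K) ↦ (k(X), K(X))` keeps the transcendence degree

Stub `stub_trdeg_ratFunc` of the crux `HigherRankTermination` (line `birth`, base-change line).
The route's syzygy index is `Cardinal.toNat (trdeg_k K)`, so the base change
`(k, K) ↦ (k(X), K(X))` must not move the transcendence degree:
`trdeg_{k(X)} K(X) = trdeg_k K`. Here `k(X)` is rendered as an abstract field `k'` with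
`k → k' → K(X)` a scalar tower and `range (k' → K(X)) = k(X) ⊆ K(X)`
(`IntermediateField.adjoin k {RatFunc.X}`).

Proof: by the tower law (Mathlib `trdeg_add_eq`, Stacks 030H) along `k ⊆ K ⊆ K(X)` and
`k ⊆ k(X) ⊆ K(X)`,
`trdeg_k K + trdeg_K K(X) = trdeg_k K(X) = trdeg_k k(X) + trdeg_{k(X)} K(X)`;
`trdeg_K K(X) = 1` (`K ⊆ K[X] ⊆ K(X)`, `Polynomial.trdeg_of_isDomain`, fraction fields are
algebraic) and `trdeg_k k(X) = 1` (`X` is transcendental over `K`, hence over `k`, and generates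
`k(X)`; `Literature.FieldTheory.TranscendenceDegree.trdeg_eq_one_of_adjoin_simple_eq_top`);
finally `a + 1 = b + 1 → a = b` for cardinals (`Cardinal.add_one_inj`). In particular the
finiteness hypothesis `trdeg_k K < ℵ₀` of the registered signature is not needed.

Sources: the additivity of the transcendence degree in towers is Stacks Project Tag 030H
(Mathlib `trdeg_add_eq`); the statement itself is folklore (e.g. the standard remark that a purely
transcendental base change of the constants does not change `trdeg`).
-/

noncomputable section

-- single-problem summit: the doubled namespace component is forced
set_option linter.dupNamespace false

open scoped NNReal

namespace Summit.ResolutionOfSingularities.ResolutionOfSingularities.Theorems.SyzygyFlattening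

open Polynomial in
/-- `trdeg_K K(X) = 1`: the tower `K ⊆ K[X] ⊆ K(X)` has `trdeg_K K[X] = 1` and `K(X)` algebraic
over `K[X]` (a fraction field). [folklore] -/
theorem trdeg_ratFunc_eq_one (K : Type*) [Field K] : Algebra.trdeg K (RatFunc K) = 1 := by
  haveI : Algebra.IsAlgebraic K[X] (RatFunc K) :=
    IsLocalization.isAlgebraic (RatFunc K) (nonZeroDivisors K[X])
  have h := trdeg_add_eq K K[X] (A := RatFunc K)
  rw [trdeg_eq_zero (R := K[X]) (A := RatFunc K), Polynomial.trdeg_of_isDomain,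
    add_zero] at h
  exact h.symm

/-- `trdeg_k K(X) = trdeg_k K + 1` for a field extension `K / k` (tower law along
`k ⊆ K ⊆ K(X)` and `trdeg_K K(X) = 1`). [folklore] -/
theorem trdeg_ratFunc_eq_add_one (k K : Type*) [Field k] [Field K] [Algebra k K] :
    Algebra.trdeg k (RatFunc K) = Algebra.trdeg k K + 1 := by
  haveI : FaithfulSMul k K :=
    (faithfulSMul_iff_algebraMap_injective k K).mpr (algebraMap k K).injective
  haveI : FaithfulSMul K (RatFunc K) :=
    (faithfulSMul_iff_algebraMap_injective K (RatFunc K)).mpr (algebraMap K (RatFunc K)).injective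
  rw [← trdeg_ratFunc_eq_one K, trdeg_add_eq k K (A := RatFunc K)]

/-- The subfield `k(X) ⊆ K(X)` generated by the variable has `trdeg_k k(X) = 1`: `X` is
transcendental over `K` (Mathlib `RatFunc.transcendental_X`), hence over `k`, and generates
`k(X)`. [folklore] -/
theorem trdeg_adjoin_X_eq_one (k K : Type*) [Field k] [Field K] [Algebra k K] :
    Algebra.trdeg k (IntermediateField.adjoin k ({RatFunc.X} : Set (RatFunc K))) = 1 := by
  have hXk : Transcendental k (RatFunc.X : RatFunc K) :=
    (RatFunc.transcendental_X (K := K)).of_tower_top k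
  have hgen : Transcendental k
      (IntermediateField.AdjoinSimple.gen k (RatFunc.X : RatFunc K)) := by
    rw [← transcendental_algebraMap_iff (algebraMap
        (IntermediateField.adjoin k ({RatFunc.X} : Set (RatFunc K))) (RatFunc K)).injective,
      IntermediateField.AdjoinSimple.algebraMap_gen]
    exact hXk
  exact Literature.FieldTheory.TranscendenceDegree.trdeg_eq_one_of_adjoin_simple_eq_top hgen
    (Literature.FieldTheory.TranscendenceDegree.adjoin_adjoinSimpleGen_eq_top _)

/-- **The base change `(k, K) ↦ (k(X), K(X))` keeps the transcendence degree**: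
if `k'` is (abstractly) the subfield `k(X)` of `K(X)` — `k → k' → K(X)` a scalar tower with
`range (k' → K(X)) = k(X)` — then `trdeg_{k'} K(X) = trdeg_k K`. Both sides satisfy
`· + 1 = trdeg_k K(X)` by the tower law (`trdeg_k k' = trdeg_k k(X) = 1`, `trdeg_K K(X) = 1`),
and `a + 1 = b + 1 → a = b` for cardinals; the finiteness hypothesis is not used. [folklore] -/
theorem stub_trdeg_ratFunc : ∀ (k K : Type) [Field k] [Field K] [Algebra k K],
    Algebra.trdeg k K < Cardinal.aleph0 →
    ∀ (k' : Type) [Field k'] [Algebra k k'] [Algebra k' (RatFunc K)] [IsScalarTower k k' (RatFunc K)],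
      Set.range (algebraMap k' (RatFunc K)) =
        ((IntermediateField.adjoin k {(RatFunc.X : RatFunc K)} : IntermediateField k (RatFunc K)) :
          Set (RatFunc K)) →
      Algebra.trdeg k' (RatFunc K) = Algebra.trdeg k K := by
  intro k K _ _ _ _ k' _ _ _ _ hrange
  -- `k' ≃ₐ[k] k(X)`, so `trdeg_k k' = 1`
  set F : IntermediateField k (RatFunc K) := IntermediateField.adjoin k {(RatFunc.X : RatFunc K)}
    with hF
  let φ : k' →ₐ[k] RatFunc K := IsScalarTower.toAlgHom k k' (RatFunc K)
  have hφ : φ.fieldRange = F := by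
    apply SetLike.coe_injective
    rw [AlgHom.coe_fieldRange]
    exact hrange
  let e : k' ≃ₐ[k] F :=
    (show k' ≃ₐ[k] φ.fieldRange from AlgEquiv.ofInjectiveField φ).trans
      (IntermediateField.equivOfEq hφ)
  have hk' : Algebra.trdeg k k' = 1 := by
    rw [e.trdeg_eq, hF]
    exact trdeg_adjoin_X_eq_one k K
  -- tower law along `k ⊆ k' ⊆ K(X)`
  haveI : FaithfulSMul k k' :=
    (faithfulSMul_iff_algebraMap_injective k k').mpr (algebraMap k k').injective
  haveI : FaithfulSMul k' (RatFunc K) :=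
    (faithfulSMul_iff_algebraMap_injective k' (RatFunc K)).mpr
      (algebraMap k' (RatFunc K)).injective
  have h2 : Algebra.trdeg k k' + Algebra.trdeg k' (RatFunc K) = Algebra.trdeg k K + 1 := by
    rw [trdeg_add_eq k k' (A := RatFunc K), trdeg_ratFunc_eq_add_one k K]
  rw [hk', add_comm] at h2
  exact Cardinal.add_one_inj.mp h2

end Summit.ResolutionOfSingularities.ResolutionOfSingularities.Theorems.SyzygyFlattening

end
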